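import Summits.BirchSwinnertonDyer.Rank1Residual.Additive.TameBranchRatCharEqPotMult
import HarnessLib

/-!
# THE (M) TWIN ON X3: `TameBranchRatCharEqAt W p` at certified pairs of X3♯(M) (`E[p]` REDUCIBLE) (additive,
# POTENTIALLY MULTIPLICATIVE, EVERY odd `p`) from Kato 17.4 (3) on the multiplicative twist `E♭` +
# Delbourgo 2002 (A)(B) (potentially multiplicative case) + the first-unit-index certificate + the
# squeeze witness / the BSD-side inequality
# (cell `b2b-bsdres`, sub-cell additive-p2 = X3♯(G-ord)/X4♯(G-ord), gen 31; part 7c — the X3♯(M) rows)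

HONEST FRAMING (cell `b2b-bsdres`, run/shared/lean/b2b/bsd-rank1-residual/, verbatim in every
file): the goal of the cell is to DELETE the COMBINATION-SHAPED residual classes of the
Birch–Swinnerton-Dyer formula for ALL analytic-rank `≤ 1` elliptic curves over `ℚ` — "full BSD
formula for every rank `≤ 1` curve in class `C`" assembled STRICTLY from published theorems — so
that the rank-`≤ 1` remainder becomes exactly the CONSTRUCTION-SHAPED classes, which are TYPED
(missing-input `Prop`s), NOT attempted. This is not "finishing BSD". The (M) rows (X3♯(M)/X4(M)) are
additive-p1's / team n1011's; this file only CONSUMES their producers by name (the AdditivePotMult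
bricks `isTorsion_and_exists_iota_eq_of_wuthrichHalf`, `ClassX3M.exists_mult_pStar_twist_model`,
gen 22's (M) dictionary) and restates nothing; labels / RESIDUAL-MAP
marks UNCHANGED; nothing is booked (the main conjecture at a pair is NOT `BSD(E,p)`). Theorems only;
published inputs are explicit binders (`hWu` = Wuthrich 2014 Thm. 16 half-eigenspace reading, `hmodD`,
`hGZK`, `hmod`, `h310`, and `LeadingTermClauses W p Dh` = Delbourgo 2002 (B), supplied on (M) by
n1011-p16's `Delbourgo2002.mainTheorem_potMult`). No definition, no named fact, no `sorry`.

## What and why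

Parts 2–5 of gen 31 settled cc-typer-2's typed rational main conjecture `TameBranchRatCharEqAt W p` at
certified defect-2 pairs of the (G-ord) cell. The OTHER defect-2 cell is (M): `E = E♭ ⊗ χ_{p*}` with
`E♭` MULTIPLICATIVE at `p`; there the integral brick is n1011-p17's
`AdditivePotMult.isTorsion_and_exists_iota_eq_of_katoHalf` (`ι g₁ = C(u·ϖ)·L^±_p(f♭, a_p, ω^{(p−1)/2}, T)`,
`a_p = ±1`, EVERY odd `p`, `p = 3` included) and the dictionary is gen 22's
`isTameBranchOf_legendre_C_mul_padicLFunction{Plus,Minus}BranchMult`; part 7a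
(`TameBranchRatCharEqPotMult.lean`) did the tuple step; part 7b holds the X4(M) ∩ {`ρ̄` onto} headlines (Kato).
THIS FILE is the X3♯(M) twin (`E[p]` REDUCIBLE, hence `E♭[p]` reducible; brick = n1011-p07's
`AdditivePotMult.isTorsion_and_exists_iota_eq_of_wuthrichHalf`, Wuthrich 2014 Thm. 16, NO image hypothesis),
EVERY odd `p` (`p = 3` included), with the (B)-datum as a binder:

* **`ClassX3M.tameBranchRatCharEqAt_of_wuthrichHalf_of_firstUnit_two_rankZero`** — `r_an = 0`, first unit
  coefficient of `ϖ·L^±_p(f♭, a_p)` at index `2` with non-zero constant term, `2·ord_p #tors < ord_p ∏c`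
  (parity route, Greenberg Prop. 3.10) ⟹ `TameBranchRatCharEqAt W p`, `μ = 0`, `λ = 2`;
* **`ClassX3M.tameBranchRatCharEqAt_of_wuthrichHalf_of_fullSqueeze_rankOne`** — `r_an = 1`, a (B)-datum,
  first unit index `n` (ANY), `[T¹] ≠ 0`, `v ≤ ord_p Reg_p(E,Dh)` and
  `v_p([T¹](ϖ·L^±)) + 1 + 2t ≤ v + ord_p ∏c` ⟹ `TameBranchRatCharEqAt W p`, Schneider,
  `ord_p Reg_p = v`, `#Ш[p^∞] = 1`, `μ = 0`, `λ = n` (no parity; the plus-symbol binder is a theorem, part 7b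
  §1b — binder-free form in part 8).

Window (EVIDENCE, X4-2 WINDOW TSV): the (M) cells hold 287 of the 429 certified rank-1 rows ((M)@3:
233 X3 + 36 X4; (M)@5: 15 X3 + 3 X4), all with full-squeeze margin `0`; the 248 X3(M) rows among them are in
the scope of this file (`p = 3` included). Nothing booked; labels UNCHANGED.

References: Kato 2004 Thm. 17.4 (3) [Kato2004Asterisque]; Wuthrich 2014 Lemma 20 [Wuthrich2014];
Delbourgo 2002 Thm. (A), (B) p. 40, p. 39 (`ℓ_p = 1` for `ord_p j < 0`) [Delbourgo2002];
Mazur–Tate–Teitelbaum 1986 §I.10, §I.13–I.14 [MazurTateTeitelbaum1986Invent]; Greenberg LNM 1716 Prop.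
3.10, §4 [GreenbergLNM1716]; `TameBranchKatoDivisibilityOfKatoMult.lean` (gen 22),
`AdditivePotMult/PotMultRankOneKatoCertificate.lean` (n1011-p17), parts 2–4 of gen 31. -/

set_option autoImplicit false

noncomputable section

open scoped Classical MatrixGroups ModularForm NumberField

open CongruenceSubgroup IsDedekindDomain WeierstrassCurve NumberField
  Literature.NumberTheory.EllipticCurves
  Literature.NumberTheory.EllipticCurves.ModularForms
  Literature.NumberTheory.EllipticCurves.Rank1Residual
  Literature.NumberTheory.EllipticCurves.Rank1Residual.Typed
  Literature.NumberTheory.EllipticCurves.Delbourgo2002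
  Literature.NumberTheory.EllipticCurves.Greenberg1999
  Literature.NumberTheory.GaloisRepresentations
  Summit.BirchSwinnertonDyer.Rank1Residual.AdditivePotMult
  Summit.BirchSwinnertonDyer.Rank1Residual.X1.MuLambda
  Summit.BirchSwinnertonDyer.Rank1Residual.X1.RankOneParitySqueeze
  Summit.BirchSwinnertonDyer.Rank1Residual.X11a.LambdaNorm

namespace Summit.BirchSwinnertonDyer.Rank1Residual.Additive

/-! ### §3 X3♯(M), EVERY odd `p`: the headlines -/

section ClassLevelMultX3

open TameBranchMuPart

variable {W : WeierstrassCurve ℚ} [W.IsElliptic] [W.IsGloballyMinimal] {p : ℕ} [hp : Fact p.Prime]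

/-- **HEADLINE X3♯(M), RANK ZERO, parity route.** X3♯(M) (`E[p]` reducible), EVERY odd `p`, `ord_{s=1} L(E,s) = 0`,
a (B)-datum `Dh` (immaterial in rank 0; supplied by `Delbourgo2002.mainTheorem_potMult`), Greenberg's
Prop. 3.10; data: for every multiplicative twist model `V` (`C • V^{(p*)} = W`), newform `f` of `V` with
`a_p(f) = ap`, period ratio `ϖ`: the series `ϖ·L^±_p(f, ap, ω^{(p−1)/2}, T)` has non-zero constant term and
FIRST UNIT coefficient at index `2`; and `2·ord_p #E(ℚ)_tors < ord_p ∏c_ℓ`. Then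
**`TameBranchRatCharEqAt W p`** and every generator of `char_Λ X(E/ℚ_∞)` has `μ = 0`, `λ = 2`.
[cite: Wuthrich2014, Thm. 16 (p. 397)] [cite: Delbourgo2002, Theorem (A), (B) (p. 40), p. 39]
[cite: GreenbergLNM1716, Prop. 3.10 and §5 p. 183] [cite: MazurTateTeitelbaum1986Invent, §I.10, §I.13–I.14] -/
theorem ClassX3M.tameBranchRatCharEqAt_of_wuthrichHalf_of_firstUnit_two_rankZero
    (hWu : Wuthrich2014.thm16_halfEigenCharIdeal_dvd_cyclotomicPrime)
    (hmodD : nonempty_modularParametrizationData)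
    (hGZK : rank_eq_analyticRank_of_analyticRank_le_one) (hmod : hasEntireLFunction_rat)
    (h310 : prop310_selmerCorank_mod_two_eq_lambdaInvariant)
    (hX : ClassX3M W p) (hr : W.analyticRank = 0)
    {Dh : PAdicHeightData W p} (hBcl : LeadingTermClauses W p Dh)
    (hcert : ∀ (V : WeierstrassCurve ℚ) [V.IsElliptic] [V.IsGloballyMinimal] (C : VariableChange ℚ),
      Mult V p → C • V.quadraticTwist ((-1 : ℚ) ^ (p / 2) * p) = W →
      ∀ {N : ℕ} [NeZero N] (f : CuspForm (Gamma0 N) 2), IsNewformOf V f → ∀ (ap : ℤ), cuspCoeff f p = ap →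
      ∀ ϖ : ℚ, (if Even (p / 2) then (ϖ : ℝ) * V.realPeriodRat = plusPeriod f
          else (ϖ : ℝ) * V.imaginaryPeriodRat = minusPeriod f) →
        PowerSeries.constantCoeff (PowerSeries.C (ϖ : ℚ_[p]) *
            (if Even (p / 2) then padicLFunctionPlusBranchMult f ((ap : ℤ) : ℚ_[p]) (p / 2)
              else padicLFunctionMinusBranchMult f ((ap : ℤ) : ℚ_[p]) (p / 2))) ≠ 0 ∧
        ‖PowerSeries.coeff 2 (PowerSeries.C (ϖ : ℚ_[p]) *
            (if Even (p / 2) then padicLFunctionPlusBranchMult f ((ap : ℤ) : ℚ_[p]) (p / 2)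
              else padicLFunctionMinusBranchMult f ((ap : ℤ) : ℚ_[p]) (p / 2)))‖ = 1 ∧
        ∀ i < 2, ‖PowerSeries.coeff i (PowerSeries.C (ϖ : ℚ_[p]) *
            (if Even (p / 2) then padicLFunctionPlusBranchMult f ((ap : ℤ) : ℚ_[p]) (p / 2)
              else padicLFunctionMinusBranchMult f ((ap : ℤ) : ℚ_[p]) (p / 2)))‖ < 1)
    (hb : 2 * padicValNat p W.torsionOrder < padicValNat p W.tamagawaProduct) :
    TameBranchRatCharEqAt W p ∧
      ∀ (κ : ZpExtension ℚ p) (γ : Field.absoluteGaloisGroup ℚ),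
        κ.IsCyclotomic → κ.IsTopGenerator γ → IsCyclotomicVariable p γ →
        ∀ (D : W.SelmerDualData κ γ) (fE : IwasawaAlgebra p), D.charIdeal = Ideal.span {fE} →
          mu fE = 0 ∧ lam fE = 2 := by
  have hp2 : p ≠ 2 := hX.p_ne_two
  obtain ⟨hmw, -⟩ := hGZK W (by rw [hr]; norm_num)
  have hr0 : W.mordellWeilRank = 0 := by rw [hmw, hr]
  have hL : W.entireLFunction 1 ≠ 0 := (W.analyticRank_eq_zero_iff_holds (hmod W)).mp hr
  obtain ⟨V, iV, iVm, C, hV, hC⟩ := hX.exists_mult_pStar_twist_model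
  haveI : NeZero (V.conductorNorm ℤ) := ⟨(V.conductorNorm_pos_holds).ne'⟩
  obtain ⟨Dm⟩ := hmodD V
  obtain ⟨ϖ, hϖ⟩ := exists_periodRatio_parity (p := p) V Dm
  have hirrV : ¬ V.HasIrreducibleModPGaloisRep p := fun hVirr ↦
    hX.classX3.1 ((irr_iff_of_model_twist (W := V) (p := p) (pStar_ne_zero p) ⟨C, hC⟩).mpr hVirr)
  -- the sign `a_p(E♭) = ±1` and the brick for every cyclotomic datum
  have hsign : ∃ ap : ℤ, cuspCoeff Dm.f p = ap ∧
      ∀ (κ : ZpExtension ℚ p) (γ : Field.absoluteGaloisGroup ℚ), κ.IsCyclotomic → κ.IsTopGenerator γ →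
        IsCyclotomicVariable p γ → ∀ D : W.SelmerDualData κ γ,
        D.IsTorsion ∧ ∃ g ∈ D.charIdeal, ∃ u : ℤ_[p]ˣ,
          iwasawaToPowerSeries p g = PowerSeries.C (((u : ℤ_[p]) : ℚ_[p]) * (ϖ : ℚ_[p])) *
            (if Even (p / 2) then padicLFunctionPlusBranchMult Dm.f ((ap : ℤ) : ℚ_[p]) (p / 2)
              else padicLFunctionMinusBranchMult Dm.f ((ap : ℤ) : ℚ_[p]) (p / 2)) := by
    by_cases hs : V.HasSplitMultiplicativeReductionAtPrime p
    · refine ⟨1, (Dm.isNewformOf.cuspCoeff_eq_one_and_sq_of_split hs).1.trans (by norm_num),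
        fun κ γ hκ hγ hcv D ↦ ?_⟩
      simpa only [Int.cast_one] using isTorsion_and_exists_iota_eq_of_wuthrichHalf hWu hp2 V C hC hirrV hκ
        hγ hcv Dm.isNewformOf D _ (Or.inr (Or.inl ⟨hs, rfl⟩)) ϖ hϖ
    · refine ⟨-1, (Dm.isNewformOf.cuspCoeff_eq_neg_one_and_dvd_of_nonsplit hV hs).1.trans
        (by norm_num), fun κ γ hκ hγ hcv D ↦ ?_⟩
      simpa only [Int.cast_neg, Int.cast_one] using isTorsion_and_exists_iota_eq_of_wuthrichHalf hWu hp2 V C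
        hC hirrV hκ hγ hcv Dm.isNewformOf D _ (Or.inr (Or.inr ⟨hV, hs, rfl⟩)) ϖ hϖ
  obtain ⟨ap, hap, hbrick⟩ := hsign
  obtain ⟨h0, hn, hlt⟩ := hcert V C hV hC Dm.f Dm.isNewformOf ap hap ϖ hϖ
  have hϖ0 : ϖ ≠ 0 := by
    rintro rfl
    apply h0
    rw [Rat.cast_zero, map_zero, zero_mul, map_zero]
  have hB0 : (if Even (p / 2) then padicLFunctionPlusBranchMult Dm.f ((ap : ℤ) : ℚ_[p]) (p / 2)
      else padicLFunctionMinusBranchMult Dm.f ((ap : ℤ) : ℚ_[p]) (p / 2)) ≠ 0 := by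
    intro e; apply h0; rw [e, mul_zero, map_zero]
  have key : ∀ (κ : ZpExtension ℚ p) (γ : Field.absoluteGaloisGroup ℚ),
      κ.IsCyclotomic → κ.IsTopGenerator γ → IsCyclotomicVariable p γ →
      ∀ (D : W.SelmerDualData κ γ) (fE : IwasawaAlgebra p), D.charIdeal = Ideal.span {fE} →
        D.IsTorsion ∧ mu fE = 0 ∧ lam fE = 2 ∧ ∃ (g₁ : IwasawaAlgebra p) (u : ℤ_[p]ˣ),
          D.charIdeal = Ideal.span {g₁} ∧ iwasawaToPowerSeries p g₁ =
            PowerSeries.C (((u : ℤ_[p]) : ℚ_[p]) * (ϖ : ℚ_[p])) *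
              (if Even (p / 2) then padicLFunctionPlusBranchMult Dm.f ((ap : ℤ) : ℚ_[p]) (p / 2)
                else padicLFunctionMinusBranchMult Dm.f ((ap : ℤ) : ℚ_[p]) (p / 2)) := by
    intro κ γ hκ hγ hγ' D fE hchar
    haveI : Module.Finite (IwasawaAlgebra p) D.X :=
      SelmerDualData.module_finite_of_isCyclotomic (W := W) (κ := κ) hκ D hγ
    obtain ⟨hXt, g, hg, u, hι⟩ := hbrick κ γ hκ hγ hγ' D
    have hn' := hn
    rw [← norm_coeff_C_unit_mul u] at hn'
    have hX0 : PowerSeries.constantCoeff (PowerSeries.C (((u : ℤ_[p]) : ℚ_[p]) * (ϖ : ℚ_[p])) *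
        (if Even (p / 2) then padicLFunctionPlusBranchMult Dm.f ((ap : ℤ) : ℚ_[p]) (p / 2)
          else padicLFunctionMinusBranchMult Dm.f ((ap : ℤ) : ℚ_[p]) (p / 2))) ≠ 0 := by
      rw [map_mul, PowerSeries.constantCoeff_C, mul_assoc]
      rw [map_mul, PowerSeries.constantCoeff_C] at h0
      exact mul_ne_zero (PadicInt.coe_ne_zero.mpr u.ne_zero) h0
    obtain ⟨hμ, hlam, hspan⟩ := charIdeal_eq_span_of_iota_eq_of_firstUnit_two_rankZero h310 hp2 hr0
      hBcl hκ hγ hγ' D hXt hchar hg hι hn' (fun i hi ↦ by rw [norm_coeff_C_unit_mul u]; exact hlt i hi)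
      hX0 hb
    exact ⟨hXt, hμ, hlam, g, u, hspan, hι⟩
  refine ⟨?_, fun κ γ hκ hγ hγ' D fE hchar ↦ ⟨(key κ γ hκ hγ hγ' D fE hchar).2.1,
    (key κ γ hκ hγ hγ' D fE hchar).2.2.1⟩⟩
  intro κ γ N _ f ε α B _ haddv _ hκ hγ hcv hf _ hα hB D
  haveI : (Literature.NumberTheory.EllipticCurves.Module.charIdeal (IwasawaAlgebra p) D.X).IsPrincipal :=
    charIdeal_isPrincipal_holds p D.X
  obtain ⟨fE, hchar⟩ := Submodule.IsPrincipal.principal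
    (Literature.NumberTheory.EllipticCurves.Module.charIdeal (IwasawaAlgebra p) D.X)
  obtain ⟨hXt, -, -, g₁, u, hspan, hι⟩ := key κ γ hκ hγ hcv D fE hchar
  have hnd : ∃ s : ℚ, ratPlusSymbol f s ≠ 0 := by
    refine ⟨0, fun h00 ↦ hL ?_⟩
    rw [hf.entireLFunction_one_eq, h00]
    simp
  exact ⟨hXt, exists_charIdeal_eq_span_and_iota_eq_of_generator_mult hp2 V C hC haddv hV hf hnd Dm hap
    hϖ0 hspan hι hB0 hα hB⟩

/-- **HEADLINE X3♯(M), RANK ONE, full route (any `λ_an`).** X3♯(M), EVERY odd `p`,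
`ord_{s=1} L(E,s) = 1`, a (B)-datum `Dh` (Delbourgo's `⟨,⟩_{p,ℚ}` via `mainTheorem_potMult`; print:
`ℓ_p = 1` for `ord_p j < 0`); data: for every multiplicative twist model, newform with `a_p = ap` and
period ratio: `[T¹](ϖ·L^±) ≠ 0`, **`v_p([T¹](ϖ·L^±)) + 1 + 2·ord_p #tors ≤ v + ord_p ∏c_ℓ`**, first unit
coefficient at `n`; one non-zero plus symbol of `E`'s newform (a theorem: part 7b §1b, binder-free form in part 8);
`v ≤ ord_p Reg_p(E,Dh)`. Then
**`TameBranchRatCharEqAt W p`**, Schneider, **`ord_p Reg_p(E,Dh) = v`**, **`#Ш(E/ℚ)[p^∞] = 1`**, and every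
generator has `μ = 0`, `λ = n`. NO parity input. [cite: Wuthrich2014, Thm. 16 (p. 397)]
[cite: Delbourgo2002, Theorem (A), (B) (p. 40), p. 39] [cite: GreenbergLNM1716, §4 pp. 102–110]
[cite: MazurTateTeitelbaum1986Invent, §I.10, §I.13–I.14] -/
theorem ClassX3M.tameBranchRatCharEqAt_of_wuthrichHalf_of_fullSqueeze_rankOne
    (hWu : Wuthrich2014.thm16_halfEigenCharIdeal_dvd_cyclotomicPrime)
    (hmodD : nonempty_modularParametrizationData)
    (hGZK : rank_eq_analyticRank_of_analyticRank_le_one)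
    (hX : ClassX3M W p) (hr : W.analyticRank = 1)
    {Dh : PAdicHeightData W p} (hBcl : LeadingTermClauses W p Dh)
    (hnd : ∀ {N : ℕ} [NeZero N] (f : CuspForm (Gamma0 N) 2), IsNewformOf W f →
      ∃ s : ℚ, ratPlusSymbol f s ≠ 0) {n : ℕ} {v : ℤ} (hv : v ≤ (padicRegulator Dh).valuation)
    (hcert : ∀ (V : WeierstrassCurve ℚ) [V.IsElliptic] [V.IsGloballyMinimal] (C : VariableChange ℚ),
      Mult V p → C • V.quadraticTwist ((-1 : ℚ) ^ (p / 2) * p) = W →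
      ∀ {N : ℕ} [NeZero N] (f : CuspForm (Gamma0 N) 2), IsNewformOf V f → ∀ (ap : ℤ), cuspCoeff f p = ap →
      ∀ ϖ : ℚ, (if Even (p / 2) then (ϖ : ℝ) * V.realPeriodRat = plusPeriod f
          else (ϖ : ℝ) * V.imaginaryPeriodRat = minusPeriod f) →
        PowerSeries.coeff 1 (PowerSeries.C (ϖ : ℚ_[p]) *
            (if Even (p / 2) then padicLFunctionPlusBranchMult f ((ap : ℤ) : ℚ_[p]) (p / 2)
              else padicLFunctionMinusBranchMult f ((ap : ℤ) : ℚ_[p]) (p / 2))) ≠ 0 ∧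
        (PowerSeries.coeff 1 (PowerSeries.C (ϖ : ℚ_[p]) *
            (if Even (p / 2) then padicLFunctionPlusBranchMult f ((ap : ℤ) : ℚ_[p]) (p / 2)
              else padicLFunctionMinusBranchMult f ((ap : ℤ) : ℚ_[p]) (p / 2)))).valuation +
            1 + 2 * padicValNat p W.torsionOrder ≤ v + padicValNat p W.tamagawaProduct ∧
        ‖PowerSeries.coeff n (PowerSeries.C (ϖ : ℚ_[p]) *
            (if Even (p / 2) then padicLFunctionPlusBranchMult f ((ap : ℤ) : ℚ_[p]) (p / 2)
              else padicLFunctionMinusBranchMult f ((ap : ℤ) : ℚ_[p]) (p / 2)))‖ = 1 ∧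
        ∀ i < n, ‖PowerSeries.coeff i (PowerSeries.C (ϖ : ℚ_[p]) *
            (if Even (p / 2) then padicLFunctionPlusBranchMult f ((ap : ℤ) : ℚ_[p]) (p / 2)
              else padicLFunctionMinusBranchMult f ((ap : ℤ) : ℚ_[p]) (p / 2)))‖ < 1) :
    TameBranchRatCharEqAt W p ∧ SchneiderConjecture Dh ∧ (padicRegulator Dh).valuation = v ∧
      Nat.card (AddCommGroup.primaryComponent W.sha p) = 1 ∧
      ∀ (κ : ZpExtension ℚ p) (γ : Field.absoluteGaloisGroup ℚ),
        κ.IsCyclotomic → κ.IsTopGenerator γ → IsCyclotomicVariable p γ →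
        ∀ (D : W.SelmerDualData κ γ) (fE : IwasawaAlgebra p), D.charIdeal = Ideal.span {fE} →
          mu fE = 0 ∧ lam fE = n := by
  have hp2 : p ≠ 2 := hX.p_ne_two
  obtain ⟨hmw, -⟩ := hGZK W (by rw [hr])
  have hr1 : W.mordellWeilRank = 1 := by rw [hmw, hr]
  obtain ⟨V, iV, iVm, C, hV, hC⟩ := hX.exists_mult_pStar_twist_model
  haveI : NeZero (V.conductorNorm ℤ) := ⟨(V.conductorNorm_pos_holds).ne'⟩
  obtain ⟨Dm⟩ := hmodD V
  obtain ⟨ϖ, hϖ⟩ := exists_periodRatio_parity (p := p) V Dm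
  have hirrV : ¬ V.HasIrreducibleModPGaloisRep p := fun hVirr ↦
    hX.classX3.1 ((irr_iff_of_model_twist (W := V) (p := p) (pStar_ne_zero p) ⟨C, hC⟩).mpr hVirr)
  have hsign : ∃ ap : ℤ, cuspCoeff Dm.f p = ap ∧
      ∀ (κ : ZpExtension ℚ p) (γ : Field.absoluteGaloisGroup ℚ), κ.IsCyclotomic → κ.IsTopGenerator γ →
        IsCyclotomicVariable p γ → ∀ D : W.SelmerDualData κ γ,
        D.IsTorsion ∧ ∃ g ∈ D.charIdeal, ∃ u : ℤ_[p]ˣ,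
          iwasawaToPowerSeries p g = PowerSeries.C (((u : ℤ_[p]) : ℚ_[p]) * (ϖ : ℚ_[p])) *
            (if Even (p / 2) then padicLFunctionPlusBranchMult Dm.f ((ap : ℤ) : ℚ_[p]) (p / 2)
              else padicLFunctionMinusBranchMult Dm.f ((ap : ℤ) : ℚ_[p]) (p / 2)) := by
    by_cases hs : V.HasSplitMultiplicativeReductionAtPrime p
    · refine ⟨1, (Dm.isNewformOf.cuspCoeff_eq_one_and_sq_of_split hs).1.trans (by norm_num),
        fun κ γ hκ hγ hcv D ↦ ?_⟩
      simpa only [Int.cast_one] using isTorsion_and_exists_iota_eq_of_wuthrichHalf hWu hp2 V C hC hirrV hκ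
        hγ hcv Dm.isNewformOf D _ (Or.inr (Or.inl ⟨hs, rfl⟩)) ϖ hϖ
    · refine ⟨-1, (Dm.isNewformOf.cuspCoeff_eq_neg_one_and_dvd_of_nonsplit hV hs).1.trans
        (by norm_num), fun κ γ hκ hγ hcv D ↦ ?_⟩
      simpa only [Int.cast_neg, Int.cast_one] using isTorsion_and_exists_iota_eq_of_wuthrichHalf hWu hp2 V C
        hC hirrV hκ hγ hcv Dm.isNewformOf D _ (Or.inr (Or.inr ⟨hV, hs, rfl⟩)) ϖ hϖ
  obtain ⟨ap, hap, hbrick⟩ := hsign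
  obtain ⟨h1, hfull, hn, hlt⟩ := hcert V C hV hC Dm.f Dm.isNewformOf ap hap ϖ hϖ
  have hϖ0 : ϖ ≠ 0 := by
    rintro rfl
    apply h1
    rw [Rat.cast_zero, map_zero, zero_mul, map_zero]
  have hB0 : (if Even (p / 2) then padicLFunctionPlusBranchMult Dm.f ((ap : ℤ) : ℚ_[p]) (p / 2)
      else padicLFunctionMinusBranchMult Dm.f ((ap : ℤ) : ℚ_[p]) (p / 2)) ≠ 0 := by
    intro e; apply h1; rw [e, mul_zero, map_zero]
  obtain ⟨κ₀, γ₀, hκ₀, hγ₀, hγ₀', D₀, fE₀, hchar₀⟩ := exists_cyclotomic_dualData_generator W p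
  have key : ∀ (κ : ZpExtension ℚ p) (γ : Field.absoluteGaloisGroup ℚ),
      κ.IsCyclotomic → κ.IsTopGenerator γ → IsCyclotomicVariable p γ →
      ∀ (D : W.SelmerDualData κ γ) (fE : IwasawaAlgebra p), D.charIdeal = Ideal.span {fE} →
        D.IsTorsion ∧ SchneiderConjecture Dh ∧ mu fE = 0 ∧ lam fE = n ∧
          Nat.card (AddCommGroup.primaryComponent W.sha p) = 1 ∧ (padicRegulator Dh).valuation = v ∧
          ∃ (g₁ : IwasawaAlgebra p) (u : ℤ_[p]ˣ),
          D.charIdeal = Ideal.span {g₁} ∧ iwasawaToPowerSeries p g₁ =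
            PowerSeries.C (((u : ℤ_[p]) : ℚ_[p]) * (ϖ : ℚ_[p])) *
              (if Even (p / 2) then padicLFunctionPlusBranchMult Dm.f ((ap : ℤ) : ℚ_[p]) (p / 2)
                else padicLFunctionMinusBranchMult Dm.f ((ap : ℤ) : ℚ_[p]) (p / 2)) := by
    intro κ γ hκ hγ hγ' D fE hchar
    haveI : Module.Finite (IwasawaAlgebra p) D.X :=
      SelmerDualData.module_finite_of_isCyclotomic (W := W) (κ := κ) hκ D hγ
    obtain ⟨hXt, g, hg, u, hι⟩ := hbrick κ γ hκ hγ hγ' D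
    have hn' := hn
    rw [← norm_coeff_C_unit_mul u] at hn'
    have hX1 : PowerSeries.coeff 1 (PowerSeries.C (((u : ℤ_[p]) : ℚ_[p]) * (ϖ : ℚ_[p])) *
        (if Even (p / 2) then padicLFunctionPlusBranchMult Dm.f ((ap : ℤ) : ℚ_[p]) (p / 2)
          else padicLFunctionMinusBranchMult Dm.f ((ap : ℤ) : ℚ_[p]) (p / 2))) ≠ 0 := by
      rw [PowerSeries.coeff_C_mul, mul_assoc]
      rw [PowerSeries.coeff_C_mul] at h1
      exact mul_ne_zero (PadicInt.coe_ne_zero.mpr u.ne_zero) h1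
    have hfull' := hfull
    rw [← valuation_coeff_C_unit_mul u _ _ 1 h1] at hfull'
    obtain ⟨hS, hμ, hlam, hcard, hReg, -, hspan⟩ := fullSqueeze_rankOne_of_iota_eq_of_firstUnit hp2
      hr1 hBcl hκ hγ hγ' D hXt hchar hg hι hn'
      (fun i hi ↦ by rw [norm_coeff_C_unit_mul u]; exact hlt i hi) hX1 hv hfull'
    exact ⟨hXt, hS, hμ, hlam, hcard, hReg, g, u, hspan, hι⟩
  obtain ⟨-, hS₀, -, -, hcard₀, hReg₀, -⟩ := key κ₀ γ₀ hκ₀ hγ₀ hγ₀' D₀ fE₀ hchar₀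
  refine ⟨?_, hS₀, hReg₀, hcard₀, fun κ γ hκ hγ hγ' D fE hchar ↦
    ⟨(key κ γ hκ hγ hγ' D fE hchar).2.2.1, (key κ γ hκ hγ hγ' D fE hchar).2.2.2.1⟩⟩
  intro κ γ N _ f ε α B _ haddv _ hκ hγ hcv hf _ hα hB D
  haveI : (Literature.NumberTheory.EllipticCurves.Module.charIdeal (IwasawaAlgebra p) D.X).IsPrincipal :=
    charIdeal_isPrincipal_holds p D.X
  obtain ⟨fE, hchar⟩ := Submodule.IsPrincipal.principal
    (Literature.NumberTheory.EllipticCurves.Module.charIdeal (IwasawaAlgebra p) D.X)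
  obtain ⟨hXt, -, -, -, -, -, g₁, u, hspan, hι⟩ := key κ γ hκ hγ hcv D fE hchar
  exact ⟨hXt, exists_charIdeal_eq_span_and_iota_eq_of_generator_mult hp2 V C hC haddv hV hf (hnd f hf) Dm
    hap hϖ0 hspan hι hB0 hα hB⟩

end ClassLevelMultX3

end Summit.BirchSwinnertonDyer.Rank1Residual.Additive

end
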